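/-
COR-CM (cell pub-hodgecm2, stage 2 of the Hodge ladder) — TRANSPOSITION item (vi), sub-binder S2 `supply`: the MODEL MATCH
(M-Sh) of the S2-CRUX owner's reading (`hReach`, `Transposition/Item6SupplyPinned.lean`), steps (d) «GAGA/Chow» and (e)
«Albanese transport» as KERNEL THEOREMS on the model universe.  Seat prover-pub-hodgecm2-item6-p2-g7-0 (item (vi) extra
prover p2, gen 7), count-neutral own lane: theorems only (no definition, no instance, no named fact, nothing asserted);
nothing under `CorCM/B01/` or `CorCM/B01/Transposition/` is edited or restated.  HC_CM is NOT proved.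
-/
import Summits.HodgeConjecture.CorCM.CMSideReachOfInverseType
import Summits.HodgeConjecture.CorCM.B01.HeckePair
import Literature.AlgebraicGeometry.ShimuraVarieties.UnitaryBallModelUnique
import Literature.AlgebraicGeometry.Motives.JacobianOfIso
import HarnessLib

/-!
# The Albanese side of the S2 object match: a ball-uniformised component IS the tree's Picard modular surface

Context.  In the pinned as-printed junction for item (vi) (own-htheta, `Transposition/Item6SupplyPinned.lean`; pin brief
HOME/INBOX 2026-08-21T16:15:07Z) the residual binder `hReach` («a non-zero `φ ∈ Hom_E(A_K, A_μ)_ℚ` yields, at SOME level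
`Γ` of the tree's `V`-tower and for some Albanese datum `𝒥` of `P_Γ(V)`, a non-zero `𝒥.J ⟶ A_μ ⊗ ℂ`») is reached from
[Liu2021] §4.2 / App. C through the step list (a)–(e) of the owner's reading (`S2-CRUX-OWNER-READING.md` §2).  Binder-2's
`CorCM/AlbaneseSideReachTransfer.lean` proves everything downstream of a product fan of TREE Albanese varieties
`∏_j Alb P_{Γ_j}(V) ↠ A_K ⊗ ℂ`.  This file moves the junction one step closer to the printed sources: the fan may be taken
over the Albanese varieties of ABSTRACT smooth projective surfaces `X_j` — the connected components of `X_K ⊗_{E,ι₁} ℂ` —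
each carrying a ball uniformisation (`UnitaryBallUniformisationDatum 2 (X j)`) by THE HERMITIAN SPACE OF `V` AT `ι₁` and a
group `Γ_j` of the `V`-tower ([Liu2021] App. C Prop. C.5: `Sh(𝕍)_K ⊗_{E,τ'} ℂ ≅ Sh(G(τ), h)_K ⊗ ℂ`; complex uniformisation
`Sh(G,h)_K(ℂ) = ⊔_g Γ_g\𝔹²`, `Γ_g = U(V)(F) ∩ gKg⁻¹`), and the identification of each `X_j` with the tree's CHOSEN surface
`P_{Γ_j}(V) = Var.scheme hU h₃ (.pms (pmsCode L ι₁ V Γ_j))` becomes a THEOREM: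

* §1 (codes) `Model.ballDatum_pmsCode_map_Γ` — the ball datum of the realised `P_Γ(V)` has group `ι₁(Γ)` in `GL₃(ℂ)`
  (clause `datum_Γ` of `pmsRealisation` + `PicardCode.ofHermitian_Γ_map`); its complex Gram matrix is `V.Hm^{ι₁}` by the
  tree's `Model.ballDatum_Hℂ` (`B01/HeckePair.lean`, reused, not restated).
* §2 (model match) `Model.exists_iso_pms_of_ballDatum` — **a smooth projective surface `X` with a ball uniformisation `D` by
  `(Hℂ = V.Hm^{ι₁}, Γ^{τ₁} = ι₁(Γ))` is ISOMORPHIC, as a `ℂ`-scheme and over the uniformisations, to `P_Γ(V)`** — the tree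
  theorem `UnitaryBallModelUnique.exists_iso_of_eq` (Mumford AG I (4.15) «at most one algebraic structure»; GAGA =
  `arapura2012_cor_15_4_6_holds`) read in the real Hodge models `BettiUniverse.realHodgeModel hHD`.  Hence
  `Model.exists_jacobian_hom_ne_zero_of_ballDatum` / `…'`: a non-zero homomorphism out of ANY Albanese datum of `X` gives one
  out of SOME / EVERY Albanese datum of `P_Γ(V)` (`Jacobian.exists_hom_ne_zero_of_iso`, Albanese transport).
* §3 (tower) `Model.exists_level_hom_ne_zero_of_componentData` (+ `_of_epi`, `_of_iso`, `_of_tmul_of_epi`): for finitely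
  many such components `(X_j, D_j, Γ_j)` with Albanese data `𝒥X_j` and a product fan `(P, π_j : P ⟶ (𝒥X j).J)`, every non-zero
  `P ⟶ B` (or `A ⟶ B` behind an epimorphism `P ⟶ A`, or a non-zero element of `ℚ ⊗ Hom(A, B)`) yields
  `∃ (Γ₀ : Level V) (𝒥₀ : Jacobian (P_{Γ₀}(V))) (u : 𝒥₀.J ⟶ B), u ≠ 0` — the consequent of `hReach` VERBATIM.  These are the
  COMPONENT-DATA twins of binder-2's tree-fan lemmas `Model.exists_level_hom_ne_zero_of_fan` / `_of_epi` / `_of_iso`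
  (`CorCM/AlbaneseSideReachTransfer.lean`, fan over Albanese data OF THE TREE'S SURFACES): here the fan is over Albanese data
  of the ABSTRACT components and the passage to the tree's surfaces is §2 — a different hypothesis list, not a restatement.
* §4 SCHEMA `Model.reach_of_componentPin`: `hReach` at a doubly pinned datum from (U1) a Hom carrier into
  `ℚ ⊗ Hom(AK K, Aμ D)` and (U3ᶜ) on good `K`: finitely many ball-uniformised COMPONENTS of the `V`-tower shape with Albanese
  data and a product fan mapping EPIMORPHICALLY onto `AK K` — the shape in which Prop. C.5 + complex uniformisation +
  «Albanese of a finite disjoint union = product» + «Albanese of a dominant morphism is surjective» deliver it, now WITHOUT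
  naming the tree's chosen surfaces in the hypothesis.  Uniform in `[L:ℚ] > 2` and in the face; nothing automorphic and
  nothing of B01-S is discharged; (U1), (U3ᶜ) are not inhabited here.  HC_CM is NOT proved.

References: Y. Liu, *Fourier–Jacobi cycles and arithmetic relative trace formula*, Camb. J. Math. 9 (2021) = arXiv:2102.11518,
§4.2 (`FJcycle.tex` l. 2053–2076), App. C Prop. C.5 (l. 4627–4637), l. 4575–4599; D. Mumford, *Algebraic Geometry I* (1981)
§4B (4.15); J. S. Milne, *Jacobian Varieties* (1986) §1, Remark 6.5; D. Mumford, *Abelian Varieties* (1970) §19 Thm. 1 Cor. 1.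
-/

noncomputable section

open CategoryTheory CategoryTheory.Limits AlgebraicGeometry
open Literature.AlgebraicGeometry.Motives
open Literature.AlgebraicGeometry.ShimuraVarieties
open Literature.AlgebraicGeometry.HodgeTheory
open Literature.NumberTheory.Automorphic.PicardCM

namespace Summit.HodgeConjecture.CorCM

namespace Model

/-! ## §1 The ball datum of the realised Picard modular surface: its group in `GL₃(ℂ)` -/

section Codes

variable (hU : BallQuotientUniformisedDatum) (h₃ : CMAbelianVarietyRealised)
  {L : CMField} {ι₁ : L →+* ℂ} {V : HermSpace3 L ι₁}

/-- The ball datum of the realised `P_Γ(V)` has group `ι₁(Γ)` read in `GL₃(ℂ)` (clause `datum_Γ` of the realisation and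
`PicardCode.ofHermitian_Γ_map`; the Gram-matrix companion is the tree's `Model.ballDatum_Hℂ`, `B01/HeckePair.lean`). [folklore] -/
theorem ballDatum_pmsCode_map_Γ (Γ : Level V) (h : (pmsCode L ι₁ V Γ).IsAnisotropic) :
    (Var.ballDatum hU h₃ (pmsCode L ι₁ V Γ) h).Γ.map
        (Matrix.GeneralLinearGroup.map (Var.ballDatum hU h₃ (pmsCode L ι₁ V Γ) h).τ₁) =
      Γ.Γ.map (Matrix.GeneralLinearGroup.map ι₁) := by
  change ((pmsRealisation hU _).datum h).Γ.map
      (Matrix.GeneralLinearGroup.map ((pmsRealisation hU _).datum h).E.subtype) = _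
  rw [(pmsRealisation hU (pmsCode L ι₁ V Γ)).datum_Γ h]
  exact PicardCode.ofHermitian_Γ_map ι₁ V.Hm Γ.Γ V.isHermitian V.signature_ι₁ V.posDef_of_ne Γ.isCongruence
    Γ.torsionFree

end Codes

/-! ## §2 The model match: a ball-uniformised surface of the `V`-tower shape IS `P_Γ(V)`; Albanese data transport -/

section ModelMatch

variable (hU : BallQuotientUniformisedDatum) (h₃ : CMAbelianVarietyRealised) (hHD : exists_isReal_hodgeModel)
  {L : CMField} {ι₁ : L →+* ℂ} {V : HermSpace3 L ι₁}

include hHD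

/-- **The model match (M-Sh), kernel form.**  A smooth projective surface `X/ℂ` with a ball uniformisation `D` whose complex
hermitian space is that of `V` at `ι₁` (`D.Hℂ = V.Hm^{ι₁}`) and whose group read in `GL₃(ℂ)` is `ι₁(Γ)` for a level `Γ` of
the `V`-tower is ISOMORPHIC to the realised Picard modular surface `P_Γ(V)` of the model universe, by an isomorphism of
`ℂ`-schemes carrying `D.unif` to the tree's uniformisation and back (Mumford AG I (4.15), tree theorem
`UnitaryBallModelUnique.exists_iso_of_eq`, read in the real Hodge models of `hHD`).  Intended `X` = a connected component
`Γ_g\𝔹²` of `Sh(𝕍)_K ⊗_{E,ι₁} ℂ`, `Γ = (U(V)(F) ∩ gKg⁻¹, gKg⁻¹)`. [cite: Mumford1981, §4B (4.15) Corollary, p. 67]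
[cite: Liu2021, App. C Prop. C.5] -/
theorem exists_iso_pms_of_ballDatum {X : SchemeOver ℂ} (D : UnitaryBallUniformisationDatum 2 X) (Γ : Level V)
    (h : (pmsCode L ι₁ V Γ).IsAnisotropic) (hH : D.Hℂ = V.Hm.map ι₁)
    (hΓ : D.Γ.map (Matrix.GeneralLinearGroup.map D.τ₁) = Γ.Γ.map (Matrix.GeneralLinearGroup.map ι₁)) :
    ∃ e : X ≅ Var.scheme hU h₃ (.pms (pmsCode L ι₁ V Γ)),
      (∀ v ∈ D.cone, AlgPoints.map e.hom (D.unif v) = (Var.ballDatum hU h₃ (pmsCode L ι₁ V Γ) h).unif v) ∧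
      (∀ w ∈ (Var.ballDatum hU h₃ (pmsCode L ι₁ V Γ) h).cone,
        AlgPoints.map e.inv ((Var.ballDatum hU h₃ (pmsCode L ι₁ V Γ) h).unif w) = D.unif w) :=
  UnitaryBallModelUnique.exists_iso_of_eq (BettiUniverse.realHodgeModel hHD D.isSmoothProjective)
    (BettiUniverse.realHodgeModel hHD (Var.isSmoothProjective hU h₃ (.pms (pmsCode L ι₁ V Γ))))
    (hH.trans (ballDatum_Hℂ hU h₃ Γ h).symm) (hΓ.trans (ballDatum_pmsCode_map_Γ hU h₃ Γ h).symm)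

/-- The model match for a CM field of degree `> 2` (anisotropy automatic, `isAnisotropic_pmsCode_of_two_lt`; every face
context has `6 ≤ [F:ℚ]`): `X ≅ P_Γ(V)`. [cite: Mumford1981, §4B (4.15) Corollary, p. 67] [cite: Liu2021, App. C Prop. C.5] -/
theorem nonempty_iso_pms_of_ballDatum (hL : 2 < Module.finrank ℚ L) {X : SchemeOver ℂ}
    (D : UnitaryBallUniformisationDatum 2 X) (Γ : Level V) (hH : D.Hℂ = V.Hm.map ι₁)
    (hΓ : D.Γ.map (Matrix.GeneralLinearGroup.map D.τ₁) = Γ.Γ.map (Matrix.GeneralLinearGroup.map ι₁)) :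
    Nonempty (X ≅ Var.scheme hU h₃ (.pms (pmsCode L ι₁ V Γ))) :=
  let ⟨e, _⟩ := exists_iso_pms_of_ballDatum hU h₃ hHD D Γ (isAnisotropic_pmsCode_of_two_lt hL Γ) hH hΓ; ⟨e⟩

/-- **Albanese transport across the model match**: with `X`, `D`, `Γ` as in `exists_iso_pms_of_ballDatum` (`2 < [L:ℚ]`), an
Albanese datum `𝒥X` of `X` and a non-zero homomorphism `𝒥X.J ⟶ B` give an Albanese datum `𝒥` of `P_Γ(V)` and a non-zero
`𝒥.J ⟶ B` (`Jacobian.exists_hom_ne_zero_of_iso`). [cite: Milne1986JacobianVarieties, §1 and Remark 6.5]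
[cite: Liu2021, §4.2 and App. C Prop. C.5] -/
theorem exists_jacobian_hom_ne_zero_of_ballDatum (hL : 2 < Module.finrank ℚ L) {X : SchemeOver ℂ}
    (D : UnitaryBallUniformisationDatum 2 X) (Γ : Level V) (hH : D.Hℂ = V.Hm.map ι₁)
    (hΓ : D.Γ.map (Matrix.GeneralLinearGroup.map D.τ₁) = Γ.Γ.map (Matrix.GeneralLinearGroup.map ι₁))
    (𝒥X : Jacobian X) {B : AbelianVariety ℂ} {w : 𝒥X.J ⟶ B} (hw : w ≠ 0) :
    ∃ (𝒥 : Jacobian (Var.scheme hU h₃ (.pms (pmsCode L ι₁ V Γ)))) (u : 𝒥.J ⟶ B), u ≠ 0 := by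
  obtain ⟨e, -⟩ := exists_iso_pms_of_ballDatum hU h₃ hHD D Γ (isAnisotropic_pmsCode_of_two_lt hL Γ) hH hΓ
  exact 𝒥X.exists_hom_ne_zero_of_iso e hw

/-- … and for EVERY Albanese datum `𝒥` of `P_Γ(V)` a non-zero `𝒥.J ⟶ B` (`Jacobian.exists_hom_ne_zero_of_iso'`: Albanese
varieties of isomorphic schemes are isomorphic). [cite: Milne1986JacobianVarieties, §1 and Remark 6.5]
[cite: Liu2021, §4.2 and App. C Prop. C.5] -/
theorem exists_hom_ne_zero_of_ballDatum (hL : 2 < Module.finrank ℚ L) {X : SchemeOver ℂ}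
    (D : UnitaryBallUniformisationDatum 2 X) (Γ : Level V) (hH : D.Hℂ = V.Hm.map ι₁)
    (hΓ : D.Γ.map (Matrix.GeneralLinearGroup.map D.τ₁) = Γ.Γ.map (Matrix.GeneralLinearGroup.map ι₁))
    (𝒥X : Jacobian X) (𝒥 : Jacobian (Var.scheme hU h₃ (.pms (pmsCode L ι₁ V Γ)))) {B : AbelianVariety ℂ}
    {w : 𝒥X.J ⟶ B} (hw : w ≠ 0) : ∃ u : 𝒥.J ⟶ B, u ≠ 0 := by
  obtain ⟨e, -⟩ := exists_iso_pms_of_ballDatum hU h₃ hHD D Γ (isAnisotropic_pmsCode_of_two_lt hL Γ) hH hΓ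
  exact 𝒥X.exists_hom_ne_zero_of_iso' 𝒥 e hw

end ModelMatch

/-! ## §3 The tower: a product fan over ball-uniformised COMPONENTS delivers the consequent of `hReach` -/

section Tower

variable (h₁ : BallQuotientUniformised) (h₃ : CMAbelianVarietyRealised) (hHD : exists_isReal_hodgeModel)
  {F : CMField} (hF : 2 < Module.finrank ℚ F) {ι₁ : F →+* ℂ} {V : HermSpace3 F ι₁}
  {J : Type} [Fintype J] [DecidableEq J] {X : J → SchemeOver ℂ} {P A B : AbelianVariety ℂ}

include hHD hF

/-- **A finite product of Albanese varieties of ball-uniformised components reaches the tree's tower** (`U = picardCMUniverse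
hHD hI h₁ h₃`; `2 < [F:ℚ]`).  For components `X_j` with ball data `D_j` of the `V`-tower shape `(V.Hm^{ι₁}, ι₁(Γ_j))`, Albanese
data `𝒥X_j` and a limit fan `(P, π_j : P ⟶ (𝒥X j).J)` (intended `P = Alb(X_K ⊗_{E,ι₁} ℂ) = ∏_g Alb(Γ_g\𝔹²)`, [Liu2021] App. C
Prop. C.5 + complex uniformisation; Albanese of a disjoint union), every non-zero `w : P ⟶ B` gives a level `Γ₀`, an Albanese
datum `𝒥₀` of the TREE's `P_{Γ₀}(V)` and a non-zero `𝒥₀.J ⟶ B` — the consequent of `hReach` verbatim (a factor with a non-zero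
map: binder-1's `CMReach.exists_inj_comp_ne_zero`; then §2). [cite: Liu2021, §4.2 and App. C Prop. C.5]
[cite: MumfordAV1970, §19 Thm. 1 Cor. 1 (p. 173)] -/
theorem exists_level_hom_ne_zero_of_componentData (D : ∀ j : J, UnitaryBallUniformisationDatum 2 (X j))
    (Γ : J → Level V) (hH : ∀ j, (D j).Hℂ = V.Hm.map ι₁)
    (hΓ : ∀ j, (D j).Γ.map (Matrix.GeneralLinearGroup.map (D j).τ₁) = (Γ j).Γ.map (Matrix.GeneralLinearGroup.map ι₁))
    (𝒥X : ∀ j : J, Jacobian (X j)) {π : (j : J) → (P ⟶ (𝒥X j).J)} (hlim : IsLimit (Fan.mk P π))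
    {w : P ⟶ B} (hw : w ≠ 0) :
    ∃ (Γ₀ : Level V) (𝒥₀ : Jacobian (Var.scheme (ballQuotientUniformisedDatum_of h₁) h₃ (.pms (pmsCode F ι₁ V Γ₀))))
      (u : 𝒥₀.J ⟶ B), u ≠ 0 := by
  obtain ⟨j, s, -, hs⟩ := CMReach.exists_inj_comp_ne_zero hlim hw
  obtain ⟨𝒥₀, u, hu⟩ := exists_jacobian_hom_ne_zero_of_ballDatum (ballQuotientUniformisedDatum_of h₁) h₃ hHD hF (D j)
    (Γ j) (hH j) (hΓ j) (𝒥X j) hs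
  exact ⟨Γ j, 𝒥₀, u, hu⟩

/-- **… behind an epimorphism `P ⟶ A`** (intended `A = A_K ⊗_{E,ι₁} ℂ`, the epimorphism = the Albanese map of the level change
`u^{K'}_K` composed with the disjoint-union isomorphism at a neat `K'`; a surjective homomorphism of complex abelian varieties
is epi, binder-2's `AlbReach.epi_of_surjective`): every non-zero `φ : A ⟶ B` gives `Γ₀`, `𝒥₀`, and a non-zero `𝒥₀.J ⟶ B`.
[cite: Liu2021, §4.2 and App. C Prop. C.5] [cite: MumfordAV1970, §19 Thm. 1 Cor. 1 (p. 173)] -/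
theorem exists_level_hom_ne_zero_of_componentData_of_epi (D : ∀ j : J, UnitaryBallUniformisationDatum 2 (X j))
    (Γ : J → Level V) (hH : ∀ j, (D j).Hℂ = V.Hm.map ι₁)
    (hΓ : ∀ j, (D j).Γ.map (Matrix.GeneralLinearGroup.map (D j).τ₁) = (Γ j).Γ.map (Matrix.GeneralLinearGroup.map ι₁))
    (𝒥X : ∀ j : J, Jacobian (X j)) {π : (j : J) → (P ⟶ (𝒥X j).J)} (hlim : IsLimit (Fan.mk P π))
    (p : P ⟶ A) [Epi p] {φ : A ⟶ B} (hφ : φ ≠ 0) :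
    ∃ (Γ₀ : Level V) (𝒥₀ : Jacobian (Var.scheme (ballQuotientUniformisedDatum_of h₁) h₃ (.pms (pmsCode F ι₁ V Γ₀))))
      (u : 𝒥₀.J ⟶ B), u ≠ 0 :=
  exists_level_hom_ne_zero_of_componentData h₁ h₃ hHD hF D Γ hH hΓ 𝒥X hlim (w := p ≫ φ)
    fun h ↦ hφ ((cancel_epi p).1 (by rw [h, comp_zero]))

/-- **… behind an isomorphism `A ≅ P`** (neat `K`: `A_K ⊗_{E,ι₁} ℂ ≅ ∏_g Alb(Γ_g\𝔹²)`): every non-zero `φ : A ⟶ B` gives `Γ₀`,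
`𝒥₀`, and a non-zero `𝒥₀.J ⟶ B`. [cite: Liu2021, §4.2 and App. C Prop. C.5] [cite: MumfordAV1970, §19 Thm. 1 Cor. 1 (p. 173)] -/
theorem exists_level_hom_ne_zero_of_componentData_of_iso (D : ∀ j : J, UnitaryBallUniformisationDatum 2 (X j))
    (Γ : J → Level V) (hH : ∀ j, (D j).Hℂ = V.Hm.map ι₁)
    (hΓ : ∀ j, (D j).Γ.map (Matrix.GeneralLinearGroup.map (D j).τ₁) = (Γ j).Γ.map (Matrix.GeneralLinearGroup.map ι₁))
    (𝒥X : ∀ j : J, Jacobian (X j)) {π : (j : J) → (P ⟶ (𝒥X j).J)} (hlim : IsLimit (Fan.mk P π))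
    (e : A ≅ P) {φ : A ⟶ B} (hφ : φ ≠ 0) :
    ∃ (Γ₀ : Level V) (𝒥₀ : Jacobian (Var.scheme (ballQuotientUniformisedDatum_of h₁) h₃ (.pms (pmsCode F ι₁ V Γ₀))))
      (u : 𝒥₀.J ⟶ B), u ≠ 0 :=
  exists_level_hom_ne_zero_of_componentData_of_epi h₁ h₃ hHD hF D Γ hH hΓ 𝒥X hlim e.inv hφ

/-- **… with the datum read in `ℚ ⊗ Hom(A, B)`** (Liu's `Hom_E(A_K, A_μ)_ℚ` after base change; binder-1's
`Model.exists_ne_zero_of_tmul_ne_zero`), behind an epimorphism `P ⟶ A`.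
[cite: Liu2021, §4.2, Thm. 4.18 (1) and App. C Prop. C.5] -/
theorem exists_level_hom_ne_zero_of_componentData_of_tmul_of_epi (D : ∀ j : J, UnitaryBallUniformisationDatum 2 (X j))
    (Γ : J → Level V) (hH : ∀ j, (D j).Hℂ = V.Hm.map ι₁)
    (hΓ : ∀ j, (D j).Γ.map (Matrix.GeneralLinearGroup.map (D j).τ₁) = (Γ j).Γ.map (Matrix.GeneralLinearGroup.map ι₁))
    (𝒥X : ∀ j : J, Jacobian (X j)) {π : (j : J) → (P ⟶ (𝒥X j).J)} (hlim : IsLimit (Fan.mk P π))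
    (p : P ⟶ A) [Epi p] {x : TensorProduct ℤ ℚ (A ⟶ B)} (hx : x ≠ 0) :
    ∃ (Γ₀ : Level V) (𝒥₀ : Jacobian (Var.scheme (ballQuotientUniformisedDatum_of h₁) h₃ (.pms (pmsCode F ι₁ V Γ₀))))
      (u : 𝒥₀.J ⟶ B), u ≠ 0 := by
  obtain ⟨φ, hφ⟩ := exists_ne_zero_of_tmul_ne_zero hx
  exact exists_level_hom_ne_zero_of_componentData_of_epi h₁ h₃ hHD hF D Γ hH hΓ 𝒥X hlim p hφ

end Tower

/-! ## §4 SCHEMA: `hReach` at a doubly pinned datum is (U1) a Hom carrier + (U3ᶜ) a fan over ball-uniformised COMPONENTS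
mapping epimorphically onto `A_K ⊗ ℂ` -/

section Schema

variable (h₁ : BallQuotientUniformised) (h₃ : CMAbelianVarietyRealised) (hHD : exists_isReal_hodgeModel)
  {F : CMField} (hF : 2 < Module.finrank ℚ F) {ι₁ : F →+* ℂ} {V : HermSpace3 F ι₁}

include hHD hF

/-- **SCHEMA for `hReach` at a second pin, component form** (`U = picardCMUniverse hHD hI h₁ h₃`; one face context
`(F, ι₁, V)`, `2 < [F:ℚ]`, one CM type at a time; outer guards are the caller's).  Abstract carriers `Lvl` (intended
`Subgroup G`, `G = U(V)(𝔸_{F⁺,f})`), `good` (intended `IsOpenCompact`), `Obj` (intended `𝒜(μ)`), `Hom K D` with a zero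
(intended `Hom_E(A_K, A_μ)_ℚ`); pins `AK K`, `Aμ D : AbelianVariety ℂ` (intended `A_K ⊗_{E,ι₁} ℂ`, `A_μ ⊗_{E,ι₁} ℂ`).
Hypotheses = the two object identifications that stay POSITED:
* (U1) `hcar` — on good `K`, a non-zero `φ ∈ Hom K D` has non-zero image in `ℚ ⊗ Hom(AK K, Aμ D)` [Liu2021 §4.2, Thm. 4.18 (1):
  the Hom group is `Hom_E(A_K, A_μ)_ℚ`; base change of homomorphisms is injective];
* (U3ᶜ) `hAlb` — on good `K`: finitely many smooth projective surfaces `X_j` (the connected components of `X_{K'} ⊗_{E,ι₁} ℂ` at a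
  neat `K' ≤ K`), each with a ball uniformisation by `(V.Hm^{ι₁}, ι₁(Γ_j))` for levels `Γ_j` of the `V`-tower [Liu2021 App. C
  Prop. C.5 + the complex uniformisation of `Sh(Res U(V), h)_{K'}`], Albanese data `𝒥X_j` [Liu2021 Def. 2.3], a product fan of
  the `(𝒥X j).J` and an EPIMORPHISM from it onto `AK K` [Albanese of a finite disjoint union = product; the Albanese map of the
  dominant `u^{K'}_K` is surjective].
Conclusion = own-htheta's `hReach` clause at `(F, ι₁, V, Φ)`: every good `K`, every `D`, every non-zero `φ` reaches some
`Alb P_Γ(V) ⟶ Aμ D` of the TREE's tower non-trivially — the tree's chosen surfaces no longer occur in the hypothesis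
(§2, Mumford AG I (4.15)).  Uniform in `[F:ℚ] > 2` and in the face.  HC_CM is NOT proved; (U1), (U3ᶜ) are not inhabited here.
[cite: Liu2021, §4.2, Thm. 4.18 (1) and App. C Prop. C.5] [cite: Mumford1981, §4B (4.15) Corollary, p. 67] -/
theorem reach_of_componentPin {Lvl Obj : Type} (good : Lvl → Prop) (Hom : Lvl → Obj → Type) [∀ K D, Zero (Hom K D)]
    (AK : Lvl → AbelianVariety ℂ) (Aμ : Obj → AbelianVariety ℂ)
    (carrier : ∀ (K : Lvl) (D : Obj), Hom K D → TensorProduct ℤ ℚ (AK K ⟶ Aμ D))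
    (hcar : ∀ (K : Lvl) (D : Obj) (φ : Hom K D), good K → φ ≠ 0 → carrier K D φ ≠ 0)
    (hAlb : ∀ K : Lvl, good K →
      ∃ (J : Type) (_ : Fintype J) (_ : DecidableEq J) (X : J → SchemeOver ℂ)
        (Dat : ∀ j : J, UnitaryBallUniformisationDatum 2 (X j)) (Γ : J → Level V)
        (_ : ∀ j, (Dat j).Hℂ = V.Hm.map ι₁)
        (_ : ∀ j, (Dat j).Γ.map (Matrix.GeneralLinearGroup.map (Dat j).τ₁) =
          (Γ j).Γ.map (Matrix.GeneralLinearGroup.map ι₁))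
        (𝒥X : ∀ j : J, Jacobian (X j)) (P : AbelianVariety ℂ) (π : (j : J) → (P ⟶ (𝒥X j).J)) (p : P ⟶ AK K),
        Nonempty (IsLimit (Fan.mk P π)) ∧ Epi p) :
    ∀ (K : Lvl) (D : Obj) (φ : Hom K D), good K → φ ≠ 0 →
      ∃ (Γ₀ : Level V) (𝒥₀ : Jacobian (Var.scheme (ballQuotientUniformisedDatum_of h₁) h₃ (.pms (pmsCode F ι₁ V Γ₀))))
        (w : 𝒥₀.J ⟶ Aμ D), w ≠ 0 := by
  intro K D φ hK hφ
  obtain ⟨J, _, _, X, Dat, Γ, hH, hΓ, 𝒥X, P, π, p, ⟨hlim⟩, hp⟩ := hAlb K hK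
  exact exists_level_hom_ne_zero_of_componentData_of_tmul_of_epi h₁ h₃ hHD hF Dat Γ hH hΓ 𝒥X hlim p
    (hcar K D φ hK hφ)

end Schema

end Model

end Summit.HodgeConjecture.CorCM

end
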